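import Mathlib
import HarnessLib

/-!
# The engine's coordinates of `𝔰𝔲(N)`: zero-sum diagonal and upper-triangular real/imaginary parts; mean subtraction as a linear surjection

HONEST FRAMING: exact (Metropolis-corrected) sampling algorithms for lattice gauge theory;
figures of merit are autocorrelation/cost numbers at stated couplings and volumes; no
continuum-physics claim.

Venture `LatticeQCDFlow` (cell pub-lqcd), topic `Exactness`, FANOUT row 9 (eng-latcore, the
engine `latflow.core`).  Reading `updates.sweep_metropolis_ref` / `sun_2d.sweep_metropolis` /
`csrc` `lc_sweep_metropolis`: the proposal is `U ← exp(X) U` with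
`d = step·(2u − 1)` (`N` uniforms), `d −= mean(d)`, `X_ii = i d_i`, and for `i < j`:
`X_ij = re + i·im`, `X_ji = −re + i·im` (`re, im = step·(2u − 1)`).  This file is the LINEAR ALGEBRA
of that recipe — NEW WORK of the cell over Mathlib; nothing is cited as a fact:

* `UpperPair N` (the index pairs `i < j`), `zeroSum N` (the diagonal vectors with `Σ d = 0`, a
  submodule of `ℝ^N`), `SUNCoords N = zeroSum N × (ℝ^{pairs} × ℝ^{pairs})` — injective coordinates of
  `𝔰𝔲(N)`; `SUNKickCoeffs N = ℝ^N × (ℝ^{pairs} × ℝ^{pairs})` — what the engine samples.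
* `sunCoordMatrix` / **`sunCoordι : SUNCoords N →ₗ[ℝ] M_N(ℂ)`** — the matrix `X` of a coordinate
  vector; **`sunCoordι_skew`** (`Xᴴ = −X`, `tr X = 0`), **`sunCoordι_injective`**,
  **`sunCoordι_range`** (every skew-Hermitian traceless matrix is a value: diagonal entries are
  `i·Im X_ii` with `Σ Im X_ii = Im tr X = 0`, and `X_ji = −conj X_ij`).
* **`meanSub : ℝ^N →ₗ[ℝ] zeroSum N`** (`d ↦ d − mean(d)·1`; `meanSub_apply_of_mem`: the identity on
  `zeroSum`; `meanSub_surjective`); **`kickCoeffMap`** `= meanSub × id`, surjective: the linear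
  surjection taking the engine's sampled coefficients to the coordinates of its kick.

NOT CLAIMED: anything probabilistic (next file); `U(N)`; an orthonormality statement for these
coordinates (not needed: the chart minorisation is qualitative).
-/

noncomputable section

namespace Summit.Ventures.LatticeQCDFlow.Exactness

open Set Function
open scoped Matrix ComplexConjugate

variable (N : ℕ)

/-! ## §1 Index types and coordinate spaces -/

/-- The strictly upper index pairs `i < j` of an `N × N` matrix. -/
abbrev UpperPair := {p : Fin N × Fin N // p.1 < p.2}

/-- The sum of the coordinates, a linear functional on `ℝ^N`. -/
def coordSum : (Fin N → ℝ) →ₗ[ℝ] ℝ where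
  toFun d := ∑ i, d i
  map_add' d e := by simp [Finset.sum_add_distrib]
  map_smul' c d := by simp [Finset.mul_sum]

/-- Evaluation of `coordSum`. -/
@[simp] theorem coordSum_apply (d : Fin N → ℝ) : coordSum N d = ∑ i, d i := rfl

/-- **The zero-sum diagonal vectors** `{d ∈ ℝ^N | Σ d = 0}`. -/
def zeroSum : Submodule ℝ (Fin N → ℝ) := LinearMap.ker (coordSum N)

/-- Membership in `zeroSum`. -/
theorem mem_zeroSum {d : Fin N → ℝ} : d ∈ zeroSum N ↔ ∑ i, d i = 0 := by
  rw [zeroSum, LinearMap.mem_ker, coordSum_apply]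

/-- **Injective coordinates of `𝔰𝔲(N)`**: zero-sum diagonal, real parts and imaginary parts of the
strictly upper entries. -/
abbrev SUNCoords := zeroSum N × ((UpperPair N → ℝ) × (UpperPair N → ℝ))

/-- **What the engine samples**: `N` diagonal numbers (before mean subtraction), real parts and
imaginary parts of the strictly upper entries. -/
abbrev SUNKickCoeffs := (Fin N → ℝ) × ((UpperPair N → ℝ) × (UpperPair N → ℝ))

/-! ## §2 The matrix of a coordinate vector -/

/-- The matrix with diagonal `i d`, upper entries `R + i I` and lower entries `−R + i I`. -/
def sunCoordMatrix (d : Fin N → ℝ) (R I : UpperPair N → ℝ) : Matrix (Fin N) (Fin N) ℂ := fun i j =>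
  if hij : i < j then (R ⟨(i, j), hij⟩ : ℂ) + (I ⟨(i, j), hij⟩ : ℂ) * Complex.I
  else if hji : j < i then -(R ⟨(j, i), hji⟩ : ℂ) + (I ⟨(j, i), hji⟩ : ℂ) * Complex.I
  else (d i : ℂ) * Complex.I

/-- Upper entries. -/
theorem sunCoordMatrix_apply_of_lt (d : Fin N → ℝ) (R I : UpperPair N → ℝ) {i j : Fin N} (hij : i < j) :
    sunCoordMatrix N d R I i j = (R ⟨(i, j), hij⟩ : ℂ) + (I ⟨(i, j), hij⟩ : ℂ) * Complex.I := by
  simp [sunCoordMatrix, hij]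

/-- Lower entries. -/
theorem sunCoordMatrix_apply_of_gt (d : Fin N → ℝ) (R I : UpperPair N → ℝ) {i j : Fin N} (hji : j < i) :
    sunCoordMatrix N d R I i j = -(R ⟨(j, i), hji⟩ : ℂ) + (I ⟨(j, i), hji⟩ : ℂ) * Complex.I := by
  have hij : ¬ i < j := not_lt.2 hji.le
  simp [sunCoordMatrix, hji, hij]

/-- Diagonal entries. -/
theorem sunCoordMatrix_apply_self (d : Fin N → ℝ) (R I : UpperPair N → ℝ) (i : Fin N) :
    sunCoordMatrix N d R I i i = (d i : ℂ) * Complex.I := by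
  simp [sunCoordMatrix]

/-- **The coordinate map `ι : SUNCoords N →ₗ[ℝ] M_N(ℂ)`.** -/
def sunCoordι : SUNCoords N →ₗ[ℝ] Matrix (Fin N) (Fin N) ℂ where
  toFun c := sunCoordMatrix N (c.1 : Fin N → ℝ) c.2.1 c.2.2
  map_add' c c' := by
    ext i j
    rcases lt_trichotomy i j with h | rfl | h
    · simp only [Matrix.add_apply, Prod.fst_add, Prod.snd_add, Submodule.coe_add,
        sunCoordMatrix_apply_of_lt N _ _ _ h, Pi.add_apply]
      push_cast; ring
    · simp only [Matrix.add_apply, Prod.fst_add, Prod.snd_add, Submodule.coe_add,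
        sunCoordMatrix_apply_self, Pi.add_apply]
      push_cast; ring
    · simp only [Matrix.add_apply, Prod.fst_add, Prod.snd_add, Submodule.coe_add,
        sunCoordMatrix_apply_of_gt N _ _ _ h, Pi.add_apply]
      push_cast; ring
  map_smul' a c := by
    ext i j
    rcases lt_trichotomy i j with h | rfl | h
    · simp only [Matrix.smul_apply, Prod.smul_fst, Prod.smul_snd, Submodule.coe_smul,
        sunCoordMatrix_apply_of_lt N _ _ _ h, Pi.smul_apply, smul_eq_mul, RingHom.id_apply, Complex.real_smul]
      push_cast; ring
    · simp only [Matrix.smul_apply, Prod.smul_fst, Prod.smul_snd, Submodule.coe_smul,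
        sunCoordMatrix_apply_self, Pi.smul_apply, smul_eq_mul, RingHom.id_apply, Complex.real_smul]
      push_cast; ring
    · simp only [Matrix.smul_apply, Prod.smul_fst, Prod.smul_snd, Submodule.coe_smul,
        sunCoordMatrix_apply_of_gt N _ _ _ h, Pi.smul_apply, smul_eq_mul, RingHom.id_apply, Complex.real_smul]
      push_cast; ring

/-- Evaluation of `sunCoordι`. -/
theorem sunCoordι_apply (c : SUNCoords N) : sunCoordι N c = sunCoordMatrix N (c.1 : Fin N → ℝ) c.2.1 c.2.2 := rfl

/-- **The values of `ι` are skew-Hermitian and traceless.** -/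
theorem sunCoordι_skew (c : SUNCoords N) : (sunCoordι N c)ᴴ = -sunCoordι N c ∧ (sunCoordι N c).trace = 0 := by
  refine ⟨?_, ?_⟩
  · ext i j
    rw [Matrix.conjTranspose_apply, Matrix.neg_apply, sunCoordι_apply]
    rcases lt_trichotomy i j with h | rfl | h
    · rw [sunCoordMatrix_apply_of_gt N _ _ _ h, sunCoordMatrix_apply_of_lt N _ _ _ h]
      simp [Complex.ext_iff]
    · rw [sunCoordMatrix_apply_self]
      simp
    · rw [sunCoordMatrix_apply_of_lt N _ _ _ h, sunCoordMatrix_apply_of_gt N _ _ _ h]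
      simp [Complex.ext_iff]
  · rw [Matrix.trace, sunCoordι_apply]
    simp only [Matrix.diag_apply, sunCoordMatrix_apply_self]
    rw [← Finset.sum_mul, ← Complex.ofReal_sum, (mem_zeroSum N).1 c.1.2, Complex.ofReal_zero, zero_mul]

/-- **`ι` is injective.** -/
theorem sunCoordι_injective : Injective (sunCoordι N) := by
  intro c c' h
  have hd : (c.1 : Fin N → ℝ) = c'.1 := by
    funext i
    have hi := congr_fun (congr_fun h i) i
    rw [sunCoordι_apply, sunCoordι_apply, sunCoordMatrix_apply_self, sunCoordMatrix_apply_self] at hi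
    have := congrArg Complex.im hi
    simpa using this
  have hRI : ∀ p : UpperPair N, c.2.1 p = c'.2.1 p ∧ c.2.2 p = c'.2.2 p := by
    rintro ⟨⟨i, j⟩, hij⟩
    have hi := congr_fun (congr_fun h i) j
    rw [sunCoordι_apply, sunCoordι_apply, sunCoordMatrix_apply_of_lt N _ _ _ hij,
      sunCoordMatrix_apply_of_lt N _ _ _ hij] at hi
    have h1 := congrArg Complex.re hi
    have h2 := congrArg Complex.im hi
    simp at h1 h2
    exact ⟨h1, h2⟩
  exact Prod.ext (Subtype.ext hd) (Prod.ext (funext fun p => (hRI p).1) (funext fun p => (hRI p).2))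

/-- **Every skew-Hermitian traceless matrix is a value of `ι`.** -/
theorem sunCoordι_range (X : Matrix (Fin N) (Fin N) ℂ) (hX : Xᴴ = -X) (hX0 : X.trace = 0) :
    X ∈ LinearMap.range (sunCoordι N) := by
  have hentry : ∀ i j, conj (X j i) = -X i j := fun i j => by
    have h := congr_fun (congr_fun hX i) j
    rwa [Matrix.conjTranspose_apply, Matrix.neg_apply] at h
  have hdiag_re : ∀ i, (X i i).re = 0 := fun i => by
    have h := congrArg Complex.re (hentry i i)
    simp at h; linarith
  have hsum : ∑ i, (X i i).im = 0 := by
    have h := congrArg Complex.im hX0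
    rw [Matrix.trace] at h
    simpa [Complex.im_sum] using h
  refine ⟨(⟨fun i => (X i i).im, (mem_zeroSum N).2 hsum⟩, fun p => (X p.1.1 p.1.2).re, fun p => (X p.1.1 p.1.2).im), ?_⟩
  ext i j
  rw [sunCoordι_apply]
  rcases lt_trichotomy i j with h | rfl | h
  · rw [sunCoordMatrix_apply_of_lt N _ _ _ h]
    exact Complex.re_add_im (X i j)
  · rw [sunCoordMatrix_apply_self]
    apply Complex.ext <;> simp [hdiag_re i]
  · rw [sunCoordMatrix_apply_of_gt N _ _ _ h]
    have h1 := hentry i j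
    apply Complex.ext
    · have := congrArg Complex.re h1; simp at this ⊢; linarith
    · have := congrArg Complex.im h1; simp at this ⊢; linarith

/-! ## §3 Mean subtraction: the engine's sampled coefficients ↦ coordinates -/

/-- The mean of the coordinates times the all-ones vector, as a linear map. -/
def meanVec : (Fin N → ℝ) →ₗ[ℝ] (Fin N → ℝ) where
  toFun d := fun _ => (∑ i, d i) / N
  map_add' d e := by ext; simp [Finset.sum_add_distrib, add_div]
  map_smul' c d := by
    ext
    simp only [Pi.smul_apply, smul_eq_mul, RingHom.id_apply]
    rw [← Finset.mul_sum, mul_div_assoc]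

/-- Evaluation of `meanVec`. -/
@[simp] theorem meanVec_apply (d : Fin N → ℝ) (i : Fin N) : meanVec N d i = (∑ i, d i) / N := rfl

/-- `d − mean(d)·1` has zero sum. -/
theorem sub_meanVec_mem (d : Fin N → ℝ) : d - meanVec N d ∈ zeroSum N := by
  rw [mem_zeroSum]
  simp only [Pi.sub_apply, meanVec_apply, Finset.sum_sub_distrib, Finset.sum_const, Finset.card_univ,
    Fintype.card_fin, nsmul_eq_mul]
  rcases Nat.eq_zero_or_pos N with hN | hN
  · subst hN; simp
  · rw [mul_div_cancel₀ _ (by exact_mod_cast hN.ne')]; ring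

/-- **Mean subtraction** `d ↦ d − mean(d)·1`, onto the zero-sum vectors. -/
def meanSub : (Fin N → ℝ) →ₗ[ℝ] zeroSum N :=
  LinearMap.codRestrict (zeroSum N) (LinearMap.id - meanVec N) fun d => sub_meanVec_mem N d

/-- Evaluation of `meanSub`. -/
@[simp] theorem coe_meanSub (d : Fin N → ℝ) : (meanSub N d : Fin N → ℝ) = d - meanVec N d := rfl

/-- On zero-sum vectors the mean is zero: `meanSub` is the identity there. -/
theorem meanSub_apply_of_mem (c : zeroSum N) : meanSub N (c : Fin N → ℝ) = c := by
  apply Subtype.ext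
  rw [coe_meanSub]
  ext i
  simp [(mem_zeroSum N).1 c.2]

/-- `meanSub` is surjective. -/
theorem meanSub_surjective : Surjective (meanSub N) := fun c => ⟨c, meanSub_apply_of_mem N c⟩

/-- **The engine's coefficient map**: mean-subtract the diagonal, keep the off-diagonal parts. -/
def kickCoeffMap : SUNKickCoeffs N →ₗ[ℝ] SUNCoords N := (meanSub N).prodMap LinearMap.id

/-- Evaluation of `kickCoeffMap`. -/
@[simp] theorem kickCoeffMap_apply (u : SUNKickCoeffs N) : kickCoeffMap N u = (meanSub N u.1, u.2) := rfl

/-- `kickCoeffMap` is surjective. -/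
theorem kickCoeffMap_surjective : Surjective (kickCoeffMap N) := by
  rintro ⟨c, z⟩
  exact ⟨((c : Fin N → ℝ), z), by rw [kickCoeffMap_apply, meanSub_apply_of_mem]⟩

/-- `kickCoeffMap` commutes with negation (it is linear). -/
theorem kickCoeffMap_neg (u : SUNKickCoeffs N) : kickCoeffMap N (-u) = -kickCoeffMap N u := map_neg _ _

end Summit.Ventures.LatticeQCDFlow.Exactness
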